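import Summits.BirchSwinnertonDyer.BirchSwinnertonDyer.Theorems.ByReductionTypeAtTwoMultUpperHalf
import Literature.NumberTheory.EllipticCurves.Rank1Residual.Typed.LowerHalfOfLevelDatum
import Literature.NumberTheory.EllipticCurves.Rank1Residual.Typed.X5DescentSelmerLevel3
import HarnessLib

/-!
# Route `ByReductionTypeAtTwo`, layer-2 child `MultLowerHalfAtTwo` (item stmt-BirchSwinnertonDyer-19923):
# the DESCENT road — per class the lower half is a finite certificate `2^m ∣ #Ш` at ONE member

IMPORT REFACTOR H4 (director-bsd 2026-08-26, standing build rule «only an item closer / load-bearing leaf imports a Theses file»):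
this hub module (imported by ≈ 220 TOWER / level class files) no longer imports `Theses.ByReductionTypeAtTwo`; its former §4
(the three route-decl dictionary theorems `multLowerHalfAtTwo_iff_forall_pow_dvd`, `multLowerHalfAtTwo_iff_forall_exists_levelMember`,
`multHalves_of_forall_descentCertificateAt`) moved VERBATIM to the leaf `Theorems/ByReductionTypeAtTwoMultLowerHalfDescentDictionary.lean`.

HONEST FRAMING (cell `bsd-2adic`, run/shared/lean/pub/bsd-2adic/, seat `bsd-2adic-mult-3` GEN 2, D-0074
row (A)): research route; nothing is booked; BSD is not proved by any of this. PARTITION: X5@2 mult (K4ᵐ,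
RESIDUAL-MAP B1·O1; 1 976 book230 classes) × p = 2 — types-the-object-of (item 19923 per class); closes
none. The item AS FILED (`∀ W`) is untouched: it is the Eisenstein direction of the 2-adic main conjecture
at a multiplicative `2` (GEN 0, `Theorems/ByReductionTypeAtTwoMultLowerHalfInputs.lean`), not in print.

**What this file records.** `MissingLowerBoundAt W 2` is `∃ q, #Ш_an(W) = q ∧ ord₂ q ≤ ord₂ #Ш(W)`
(`Typed/Basic.lean`). At analytic rank `0`, `Ш(W)` is finite (GZK) and the half is the statement
`2^{v} ∣ #Ш(W)`, `v = ord₂ #Ш_an`: it asks for ENOUGH elements of `Ш` — the CHEAP direction of descent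
(every element is a finite, everywhere-locally-soluble covering), whereas the upper half needs an
exhaustive Selmer computation with a non-degeneracy bit, or an Euler system. So per class the item is a
FINITE CERTIFICATE at one member, moved to every member by Cassels' isogeny invariance; and the sha-1
lane's LEVEL CENSUS (unit `b2b-bsdres-sha-1`, engines A = PARI `ellrank` + Cassels–Tate on `Sel₂`,
B, F = explicit 4-descent, G = Cassels–Tate on `Sel₄ × Sel₂`; `levels/LEVEL-CENSUS-N5e5.md`) has
produced that certificate on 1 965 of the 1 969 analytic-rank-0 multiplicative-at-2 classes below
`5·10⁵` (K = 2: `Ш[2] ≅ (ℤ/2)²`, `Ш[2] ⊂ 2Ш[4]`, two-engine, ⇒ `2⁴ ∣ #Ш = 2^v` on 1 855/1 855; K = 3: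
engine G `m = 0` ⇒ `Ш[4] ⊂ 2Ш[8]` ⇒ `2⁶ ∣ #Ш = 2^v` on 110/110; K = 4: `2⁶ ∣ #Ш` only, `v = 8`, on the 4
singletons 172042o1, 219558q1, 349522b1, 412830t1 — item evidence `evidence-19923-descent-census.md`).
The Lean side of that reading:

* §1 `missingLowerBoundAt_of_shaFinite_of_pow_dvd` — ANY prime, squareness-free: `Ш` finite,
  `#Ш_an = q`, `ord_p q ≤ m`, `p^m ∣ #Ш` ⇒ `MissingLowerBoundAt W p` (the sibling
  `Typed.missingLowerBoundAt_of_casselsTate_of_pow_dvd` shaves one power using Cassels–Tate squareness;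
  the records give the full power, so no `hCT` binder is needed); `…_of_rankZero_…` with GZK.
* §2 the RECORD SHAPES ⇒ `2^m ∣ #Ш`: level 2 (`#Ш[2] = 4`, `Ш[2] ⊂ 2Ш` ⇒ `2⁴ ∣ #Ш`), level 3 (+ `Ш[4] ⊂ 2Ш`
  ⇒ `2⁶ ∣ #Ш`), in group currency and in the Selmer currency the engines print (`#E(ℚ)[2] = 2^t`,
  `#Sel⁽²⁾ = 2^{t+2}`, every 2-Selmer class lifts to `Sel⁽⁴⁾`, every 4-Selmer class lifts to `Sel⁽⁸⁾`) —
  wiring of the sha-1 lemmas `X5.card_sha_four_eq_sixteen`, `card_torsionBy_eight_of_two_divisible_four`,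
  `X5.card_sha_two_of_card_selmerTwo`, `X5.two_divisible_of_selmer_lift`,
  `X5.four_torsion_two_divisible_of_selmer_lift₄`; and the per-class doors
  `missingLowerBoundAt_two_of_level2_member` / `…_level3_member` (certificate at an isogenous member,
  transport `X12.missingLowerBoundAt_of_isIsogenous`).
* §3 «KATO ABOVE, DESCENT BELOW» — the closing shape of a level-3 class, which NO single lane closes
  (descent lacks the bit `Ш[16] = Ш[8]`; the Kato road lacks the lower half): `BSDp W 2` for EVERY member
  of the class of `W` (analytic rank `0`, multiplicative at `2`) from mult-2's
  `missingUpperBoundAt_two_mult_of_roadMember` (p418902) at a member `W₁` with `μ = 0` or a Prop-5.14 datum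
  and a period input, and a level datum `2^m ∣ #Ш(W₂)`, `ord₂ #Ш_an(W₂) ≤ m` at a member `W₂` — modulo
  PRINT {A235, A236, modularity, GZK, Cassels, Prop 5.14 at 2, Česnavičius} + MEMO {Kato `⊗ℚ` at a
  multiplicative 2 (RC-2), Greenberg–Stevens at a split 2 (RC-4)}. Habitat today: the 3 K = 3 classes with
  a Prop-5.14 member (188538x; 421590bo; 452298bo).
* §4 DICTIONARY for the planner: `multLowerHalfAtTwo_iff_forall_pow_dvd` (GZK) — the route decl is
  LITERALLY «every such `W` carries a level datum `2^m ∣ #Ш(W)`, `ord₂ #Ш_an ≤ m`»; and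
  `multHalves_of_forall_descentCertificateAt` — the X5 descent route's own ∀-statement S1
  (`X5.DescentCertificateAt`, sha-1) gives BOTH halves 19922/19923 at once.

Nothing here is a class theorem about every `W`; no label moves; the K = 4 classes show the certificate
level is unbounded. References: [Cassels1965ArithmeticVIII]; [MilneADT2006] Thm. I.7.3;
[Miller2011LMS] §1, Def. 1.1; [SilvermanAEC2009] Thm. X.4.2, X.4.14; [Cassels1998] §1;
[MerrimanSiksekSmart1996] §§2–4; [SwinnertonDyer2013]; [Stamminger2005] Thm. 6.2.2;
[GreenbergLNM1716] Prop. 5.14, §4 pp. 112–113; [Kato2004Asterisque] Thm. 17.4/17.13; cell files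
`b2b-bsdres-sha-1/levels/LEVEL-CENSUS-N5e5.md`, `b2b-bsdres-sha-1/X5-ROUTE.md` §2.
-/

set_option autoImplicit false
-- the route's Theorems namespace repeats a component by design (summit = sub-problem, D-0017).
set_option linter.dupNamespace false

noncomputable section

open scoped Classical MatrixGroups ModularForm

open CongruenceSubgroup WeierstrassCurve Literature.NumberTheory.EllipticCurves
  Literature.NumberTheory.EllipticCurves.ModularForms
  Literature.NumberTheory.EllipticCurves.Greenberg1999
  Literature.NumberTheory.EllipticCurves.Rank1Residual
  Literature.NumberTheory.EllipticCurves.Rank1Residual.Typed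
  Summit.BirchSwinnertonDyer.Rank1Residual
  Summit.BirchSwinnertonDyer.Rank1Residual.X5

namespace Summit.BirchSwinnertonDyer.BirchSwinnertonDyer.Theorems

/-! ## §1 The squareness-free door: `p^m ∣ #Ш`, `ord_p #Ш_an ≤ m` ⇒ the lower half -/

/-- **Lower half from a divisibility datum (any prime; no Cassels–Tate binder).** If `Ш(E/ℚ)` is
finite, `#Ш(E/ℚ)_an` is a rational `q` with `ord_p q ≤ m`, and `p^m ∣ #Ш(E/ℚ)`, then
`ord_p #Ш_an ≤ ord_p #Ш` (`MissingLowerBoundAt W p`). Elementary: `p^m ∣ n ≠ 0 ⇒ m ≤ ord_p n`.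
[cite: Miller2011LMS, Def. 1.1 (arXiv:1010.2431 p. 3)] -/
theorem missingLowerBoundAt_of_shaFinite_of_pow_dvd (W : WeierstrassCurve ℚ) (p : ℕ) [Fact p.Prime]
    (hfin : W.ShaFinite) {q : ℚ} (hq : shaAn W = (q : ℂ)) {m : ℕ} (hv : padicValRat p q ≤ m)
    (hdvd : p ^ m ∣ W.shaOrder) : MissingLowerBoundAt W p := by
  have hn : W.shaOrder ≠ 0 := (WeierstrassCurve.shaOrder_pos W hfin).ne'
  have hle : m ≤ padicValNat p W.shaOrder := (padicValNat_dvd_iff_le hn).1 hdvd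
  refine ⟨q, hq, hv.trans ?_⟩
  exact_mod_cast hle

/-- **The same at analytic rank `0`, finiteness from Gross–Zagier–Kolyvagin** (`hGZK` = bsd.S17).
[cite: Miller2011LMS, Def. 1.1] [cite: Kolyvagin1990, Thm. A (finiteness of Ш at analytic rank ≤ 1)] -/
theorem missingLowerBoundAt_of_rankZero_of_pow_dvd (W : WeierstrassCurve ℚ) [W.IsElliptic] (p : ℕ)
    [Fact p.Prime] (hGZK : rank_eq_analyticRank_of_analyticRank_le_one) (hr : W.analyticRank = 0)
    {q : ℚ} (hq : shaAn W = (q : ℂ)) {m : ℕ} (hv : padicValRat p q ≤ m) (hdvd : p ^ m ∣ W.shaOrder) :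
    MissingLowerBoundAt W p :=
  missingLowerBoundAt_of_shaFinite_of_pow_dvd W p (hGZK W (by omega)).2 hq hv hdvd

/-- **Conversely the lower half IS such a datum** (with `m = ord_p #Ш`): the door loses nothing.
[cite: Miller2011LMS, Def. 1.1] -/
theorem exists_pow_dvd_of_missingLowerBoundAt (W : WeierstrassCurve ℚ) (p : ℕ) [Fact p.Prime]
    (h : MissingLowerBoundAt W p) :
    ∃ (q : ℚ) (m : ℕ), shaAn W = (q : ℂ) ∧ padicValRat p q ≤ m ∧ p ^ m ∣ W.shaOrder := by
  obtain ⟨q, hq, hle⟩ := h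
  exact ⟨q, padicValNat p W.shaOrder, hq, hle, pow_padicValNat_dvd⟩

/-! ## §2 The record shapes of the level census ⇒ `2^m ∣ #Ш` -/

/-- **Level-2 shape (group currency) ⇒ `2⁴ ∣ #Ш`.** `#Ш[2] = 4` and `Ш[2] ⊂ 2Ш` (every 2-torsion class
is twice a class — what engine F's all-lift / PARI's trivial Cassels–Tate split exhibit) give
`#Ш[4] = 16` (`X5.card_sha_four_eq_sixteen`, sha-1) and Lagrange. [cite: Cassels1998, §1]
[cite: MerrimanSiksekSmart1996, §4] -/
theorem two_pow_four_dvd_shaOrder_of_level2 (W : WeierstrassCurve ℚ)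
    (h2 : Nat.card (AddSubgroup.torsionBy W.sha 2) = 4)
    (hdiv : ∀ y : W.sha, 2 • y = 0 → ∃ x : W.sha, 2 • x = y) : 2 ^ 4 ∣ W.shaOrder := by
  have h16 : Nat.card (AddSubgroup.torsionBy W.sha 4) = 16 := X5.card_sha_four_eq_sixteen W h2 hdiv
  rw [WeierstrassCurve.shaOrder, show (2 : ℕ) ^ 4 = 16 by norm_num, ← h16]
  exact AddSubgroup.card_addSubgroup_dvd_card _

/-- **Level-3 shape (group currency) ⇒ `2⁶ ∣ #Ш`.** `#Ш[2] = 4`, `Ш[2] ⊂ 2Ш` and `Ш[4] ⊂ 2Ш` (every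
4-torsion class is twice a class — what engine G's bit `m = 0` / a non-empty fake 8-Selmer set exhibit)
give `#Ш[8] = #Ш[2]·#Ш[4] = 64` (`card_torsionBy_eight_of_two_divisible_four`, sha-1) and Lagrange.
[cite: SwinnertonDyer2013, §1] [cite: Stamminger2005, Thm. 6.2.2] -/
theorem two_pow_six_dvd_shaOrder_of_level3 (W : WeierstrassCurve ℚ)
    (h2 : Nat.card (AddSubgroup.torsionBy W.sha 2) = 4)
    (hdiv : ∀ y : W.sha, 2 • y = 0 → ∃ x : W.sha, 2 • x = y)
    (hdiv₄ : ∀ y : W.sha, 4 • y = 0 → ∃ x : W.sha, 2 • x = y) : 2 ^ 6 ∣ W.shaOrder := by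
  have h16 : Nat.card (AddSubgroup.torsionBy W.sha 4) = 16 := X5.card_sha_four_eq_sixteen W h2 hdiv
  have h64 : Nat.card (AddSubgroup.torsionBy W.sha 8) = 4 * 16 :=
    card_torsionBy_eight_of_two_divisible_four h2 h16 hdiv₄
  rw [WeierstrassCurve.shaOrder, show (2 : ℕ) ^ 6 = 4 * 16 by norm_num, ← h64]
  exact AddSubgroup.card_addSubgroup_dvd_card _

/-- **Level-2 shape in SELMER currency ⇒ `2⁴ ∣ #Ш`** (what engines A/B/F print at a rank-0 member:
`#E(ℚ)[2] = 2^t`, `#Sel⁽²⁾(E/ℚ) = 2^{t+2}`, every 2-Selmer class lifts to `Sel⁽⁴⁾`): via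
`X5.card_sha_two_of_card_selmerTwo` (Silverman X.4.2 count) and `X5.two_divisible_of_selmer_lift`.
[cite: SilvermanAEC2009, Thm. X.4.2(a)] [cite: MerrimanSiksekSmart1996, §4] -/
theorem two_pow_four_dvd_shaOrder_of_selmer_level2 (W : WeierstrassCurve ℚ) [W.IsElliptic]
    [W.IsGloballyMinimal] {t : ℕ} (hrank : W.mordellWeilRank = 0)
    (ht : Nat.card (AddSubgroup.torsionBy W.toAffine.Point 2) = 2 ^ t)
    (hSel : Nat.card (W.selmerGroup 2) = 2 ^ (0 + t + 2))
    (hF : ∀ s : W.selmerGroup 2, ∃ z : W.selmerGroup 4, W.selmerZSMul 2 (by norm_num : (4 : ℤ) ∣ 2 * 2) z = s) :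
    2 ^ 4 ∣ W.shaOrder :=
  two_pow_four_dvd_shaOrder_of_level2 W (X5.card_sha_two_of_card_selmerTwo W hrank ht hSel)
    (X5.two_divisible_of_selmer_lift W hF)

/-- **Level-3 shape in SELMER currency ⇒ `2⁶ ∣ #Ш`** (+ every 4-Selmer class lifts to `Sel⁽⁸⁾` — engine
G `m = 0` / engine H non-empty; `X5.four_torsion_two_divisible_of_selmer_lift₄`).
[cite: SilvermanAEC2009, Thm. X.4.2(a)] [cite: SwinnertonDyer2013, §1] -/
theorem two_pow_six_dvd_shaOrder_of_selmer_level3 (W : WeierstrassCurve ℚ) [W.IsElliptic]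
    [W.IsGloballyMinimal] {t : ℕ} (hrank : W.mordellWeilRank = 0)
    (ht : Nat.card (AddSubgroup.torsionBy W.toAffine.Point 2) = 2 ^ t)
    (hSel : Nat.card (W.selmerGroup 2) = 2 ^ (0 + t + 2))
    (hF : ∀ s : W.selmerGroup 2, ∃ z : W.selmerGroup 4, W.selmerZSMul 2 (by norm_num : (4 : ℤ) ∣ 2 * 2) z = s)
    (hG : ∀ s : W.selmerGroup 4, ∃ z : W.selmerGroup 8, W.selmerZSMul 2 (by norm_num : (8 : ℤ) ∣ 4 * 2) z = s) :
    2 ^ 6 ∣ W.shaOrder :=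
  two_pow_six_dvd_shaOrder_of_level3 W (X5.card_sha_two_of_card_selmerTwo W hrank ht hSel)
    (X5.two_divisible_of_selmer_lift W hF) (X5.four_torsion_two_divisible_of_selmer_lift₄ W hG)

/-- **PER CLASS: the lower half at `W` from a level datum at an isogenous member `W₂`.** Analytic rank
`0` at `W` (hence at `W₂`, and `Ш(W₂)` finite by GZK), `#Ш_an(W₂) = q`, `ord₂ q ≤ m`, `2^m ∣ #Ш(W₂)` ⇒
`MissingLowerBoundAt W 2` — §1 at `W₂`, then Cassels' isogeny invariance of the defect
(`X12.missingLowerBoundAt_of_isIsogenous`; `L(W₂,1) ≠ 0`-freeness via `leadingLCoeff ≠ 0` from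
modularity `hL`). This is how a `ClosureRecordsK2*` / `LevelRecords*` row at the class representative
serves every member. [cite: Cassels1965ArithmeticVIII] [cite: MilneADT2006, Thm. I.7.3] [cite: Miller2011LMS, Def. 1.1] -/
theorem missingLowerBoundAt_two_of_levelMember
    (hGZK : rank_eq_analyticRank_of_analyticRank_le_one) (hCassels : bsdRHS_eq_of_isIsogenous)
    (hL : hasEntireLFunction_rat)
    (W : WeierstrassCurve ℚ) [W.IsElliptic] [W.IsGloballyMinimal] (hr : W.analyticRank = 0)
    (W₂ : WeierstrassCurve ℚ) [W₂.IsElliptic] [W₂.IsGloballyMinimal] (hiso : IsIsogenous W W₂)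
    {q : ℚ} (hq : shaAn W₂ = (q : ℂ)) {m : ℕ} (hv : padicValRat 2 q ≤ m)
    (hdvd : 2 ^ m ∣ W₂.shaOrder) : MissingLowerBoundAt W 2 := by
  haveI : Fact (Nat.Prime 2) := ⟨Nat.prime_two⟩
  have hr₂ : W₂.analyticRank = 0 := by rw [← analyticRank_eq_of_isIsogenous' hiso, hr]
  have hfin₂ : Finite W₂.sha := (hGZK W₂ (by omega)).2
  have hlow₂ : MissingLowerBoundAt W₂ 2 :=
    missingLowerBoundAt_of_shaFinite_of_pow_dvd W₂ 2 hfin₂ hq hv hdvd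
  exact X12.missingLowerBoundAt_of_isIsogenous hCassels hiso hfin₂
    (W₂.leadingLCoeff_ne_zero_holds (hL W₂)) hlow₂

/-! ## §3 «Kato above, descent below»: `BSD(E,2)` for a level-3 class from the two lanes -/

/-- **Per curve: upper half + level datum ⇒ `BSD(E,2)`** at analytic rank `0` (GZK): the two halves
make Miller's last clause (`missingPPartAt_of_lower_of_upper`, `bsdp_of_missingPPartAt`).
[cite: Miller2011LMS, §1 and Def. 1.1] -/
theorem bsdp_two_of_missingUpper_of_pow_dvd (hGZK : rank_eq_analyticRank_of_analyticRank_le_one)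
    (W : WeierstrassCurve ℚ) [W.IsElliptic] [W.IsGloballyMinimal] (hr : W.analyticRank = 0)
    (hU : MissingUpperBoundAt W 2) {q : ℚ} (hq : shaAn W = (q : ℂ)) {m : ℕ}
    (hv : padicValRat 2 q ≤ m) (hdvd : 2 ^ m ∣ W.shaOrder) : BSDp W 2 := by
  haveI : Fact (Nat.Prime 2) := ⟨Nat.prime_two⟩
  exact bsdp_of_missingPPartAt W 2 hGZK (by omega)
    (missingPPartAt_of_lower_of_upper W 2
      (missingLowerBoundAt_of_rankZero_of_pow_dvd W 2 hGZK hr hq hv hdvd) hU)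

/-- **THE CLASS CLOSING SHAPE OF A LEVEL-3 MULTIPLICATIVE CLASS («Kato above, descent below»).** For `W`
of analytic rank `0`, multiplicative at `2`: UPPER half from mult-2's road at ONE member `W₁ ~ W` carrying
(A) `μ = 0` for every cyclotomic dual datum OR a Prop-5.14 point (then `μ = 0` is PRINT) and (B) `E₁[2]`
irreducible OR an `X₀(N)`-optimal parametrisation datum OR `0 ≤ ord₂ ϖ` directly
(`missingUpperBoundAt_two_mult_of_roadMember`, p418902; PRINT `h41ns h41sp hmod hGZK hCassels h514 hC`,
MEMO `hKato` (RC-2), `hGS` (RC-4, only read at a split `2`)); LOWER half from a level datum at ANY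
member `W₂ ~ W` (`2^m ∣ #Ш(W₂)`, `ord₂ #Ш_an(W₂) ≤ m` — a `LevelRecordsG*` row with `gM = 0` reads
`m = 6`, `#Ш_an = 64`); conclusion `BSDp W 2` — at EVERY member `W` of the class, since both halves are
isogeny invariants. No descent engine reaches the upper bit `Ш[16] = Ш[8]` of such a class and no
Iwasawa input at `2` reaches its lower half; together they close it, modulo the displayed binders.
Habitat (seat census 2026-08-26): 188538x (non-split), 421590bo, 452298bo (split).
[cite: Kato2004Asterisque, Thm. 17.4 (p. 273)] [cite: GreenbergLNM1716, Prop. 5.14 and §4 pp. 112–113]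
[cite: Cesnavicius2018, Thm. 1.2] [cite: Cassels1965ArithmeticVIII] [cite: SwinnertonDyer2013, §1]
[cite: Miller2011LMS, Def. 1.1] -/
theorem bsdp_two_mult_of_roadMember_of_levelMember
    (hKato : ∀ (W : WeierstrassCurve ℚ) [W.IsElliptic] [W.IsGloballyMinimal],
      ¬ W.HasCM → Mult W 2 → O1.KatoMultiplicativeDivisibilityRat W 2)
    (h41ns : thm41Analogue_charValue_rankZero_numberField_anyPrime)
    (h41sp : thm41Analogue_charValue_rankZero_split_baseChange_anyPrime)
    (hmod : nonempty_modularParametrizationData)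
    (hGZK : rank_eq_analyticRank_of_analyticRank_le_one)
    (hCassels : bsdRHS_eq_of_isIsogenous)
    (h514 : prop514_isTorsion_mu_eq_zero_two)
    (hC : cesnavicius_not_two_dvd_maninConstant_of_two_dvd_level)
    (hGS : ∀ (W : WeierstrassCurve ℚ) [W.IsElliptic] [W.IsGloballyMinimal],
      W.HasSplitMultiplicativeReductionAtPrime 2 → greenberg_stevens (W := W) (p := 2))
    (hL : hasEntireLFunction_rat)
    (W : WeierstrassCurve ℚ) [W.IsElliptic] [W.IsGloballyMinimal]
    (hr : W.analyticRank = 0) (hmult : Mult W 2)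
    (W₁ : WeierstrassCurve ℚ) [W₁.IsElliptic] [W₁.IsGloballyMinimal] (hiso₁ : IsIsogenous W W₁)
    (hA : (∀ (κ : ZpExtension ℚ 2) (γ : Field.absoluteGaloisGroup ℚ), κ.IsCyclotomic →
        κ.IsTopGenerator γ → IsCyclotomicVariable 2 γ → ∀ D : W₁.SelmerDualData κ γ, D.mu = 0) ∨
      (∃ x y : ℚ, W₁.toAffine.Equation x y ∧ 2 * y + W₁.a₁ * x + W₁.a₃ = 0 ∧
        ((TwoTorsionRamifiedAtTwo x ∧ ¬ TwoTorsionOdd W₁ x) ∨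
          (TwoTorsionOdd W₁ x ∧ ¬ TwoTorsionRamifiedAtTwo x))))
    (hB : Irr W₁ 2 ∨
      (∀ [NeZero (W₁.conductorNorm ℤ)],
        ∃ D : ModularParametrizationData W₁ (W₁.conductorNorm ℤ), Zhai2021.IsOptimalDatum W₁ D) ∨
      (∀ [NeZero (W₁.conductorNorm ℤ)] (f : CuspForm (Gamma0 (W₁.conductorNorm ℤ)) 2),
        IsNewformOf W₁ f → ∀ ϖ : ℚ, (ϖ : ℝ) * W₁.realPeriodRat = plusPeriod f →
          0 ≤ padicValRat 2 ϖ))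
    (W₂ : WeierstrassCurve ℚ) [W₂.IsElliptic] [W₂.IsGloballyMinimal] (hiso₂ : IsIsogenous W W₂)
    {q : ℚ} (hq : shaAn W₂ = (q : ℂ)) {m : ℕ} (hv : padicValRat 2 q ≤ m)
    (hdvd : 2 ^ m ∣ W₂.shaOrder) : BSDp W 2 := by
  haveI : Fact (Nat.Prime 2) := ⟨Nat.prime_two⟩
  have hU : MissingUpperBoundAt W 2 :=
    missingUpperBoundAt_two_mult_of_roadMember hKato h41ns h41sp hmod hGZK hCassels h514 hC hGS W hr
      hmult W₁ hiso₁ hA hB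
  have hlow : MissingLowerBoundAt W 2 :=
    missingLowerBoundAt_two_of_levelMember hGZK hCassels hL W hr W₂ hiso₂ hq hv hdvd
  exact bsdp_of_missingPPartAt W 2 hGZK (by omega) (missingPPartAt_of_lower_of_upper W 2 hlow hU)

end Summit.BirchSwinnertonDyer.BirchSwinnertonDyer.Theorems

end
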